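import Literature.Computability.AlgebraicComplexity.VSBRBoolean
import Literature.Computability.AlgebraicComplexity.BurgisserFiniteFields
import Literature.Computability.AlgebraicComplexity.DepthReductionProofs
import HarnessLib

/-!
# `BP(VP_k) ⊆ FNC²/poly` over a finite field: discharge of (B3)
`booleanPart_VP_NC_two_of_finite`

Trunk T-CPLX-ALG. This file proves the named fact (B3)
`Literature.Computability.AlgebraicComplexity.booleanPart_VP_NC_two_of_finite k` of
`BurgisserFiniteFields.lean` (Bürgisser, *Cook's versus Valiant's hypothesis*, TCS 235 (2000),
Thm. 1.1(2), p. 73: "For finite fields of characteristic `p` we have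
`FNC¹/poly ⊆ BP(VP_k) ⊆ FNC²/poly`", second inclusion, in the language form consumed by
Cor. 1.2(2)) along the printed proof (§5 (B), p. 87): "To prove `BP(VP_k) ⊆ FNC²/poly` we start as
in (A3) with straight-line programs `Γₙ` of size `n^{O(1)}` and depth `O(log² n)` using constants in
`k` [Thm. 2.5 = Valiant–Skyum–Berkowitz–Rackoff]. As `k` is finite, `Γₙ` can be directly simulated
by Boolean circuits of size `n^{O(1)}` and depth `O(log² n)`."

The two ingredients are in the tree: the stages of the VSBR parallel evaluation of a homogeneous
circuit certificate and their realisation by `B₂`-circuits over one-hot codes of the field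
elements (`VSBRStages.lean`, `VSBRBoolean.lean`: `stageReal`, `entry_inl_eq`), and the
homogenisation of the straight-line program of an optimal fan-in-two circuit
(`GateQuotients.lean`: `SLP.homogenize`, `SLP.card_node_le`; `DepthReductionProofs.lean`:
`exists_slp`). No definitions are introduced; depths and sizes are written out in terms of the
stage bounds `stageZeroDepth`, `stageDepth`, `stageZeroSize`, `stageSize` of `VSBRBoolean.lean`.
Here:

* `HomCircuit.ncVec_decide_sum_val_eq` — for a homogeneous circuit `H` with formal degrees `≤ D`
  over a finite commutative semiring, the bit `[Σⱼ [νⱼ](x) = a]` for `M ≥ 1` nodes `νⱼ` is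
  realised at depth `stageZeroDepth + ⌈log₂ D⌉ · stageDepth + ⌈log₂ M⌉ (4 #k + 1) + (2 #k + 1)`
  (all stages, one balanced tree of addition gadgets, one comparison gadget), with the matching
  size; the stage bounds are monotone in the number of nodes (`stageZeroDepth_mono`, …);
* `ncVec_decide_eval_slp_eq`, `ncVec_decide_eval_eq` — hence `[f(x) = a]` for a value `f` of a
  straight-line program of length `L` and degree `≤ d` (summing the `d + 1` homogeneous components
  of the output line of `SLP.homogenize d`, at most `4 L (d+1)²` nodes), and for every polynomial
  `f` with `L = complexity f`, `d = deg f` (`exists_slp`; a variable or a constant output is an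
  input literal or a constant code word compared with `a`);
* the bookkeeping: the depth is a quadratic polynomial in any common bound `T` of the four
  logarithms involved (`evalDepth_le_quad`), every `⌈log₂ ·⌉` of a p-bounded quantity is
  `≤ e log₂ n + 2e + 1` (`clog_two_le_of_le_pow_add`), whence depth `≤ c log₂² n + c`
  (`evalDepth_le_log_sq`); the size is p-bounded along p-bounded `L`, `d` (`isPBounded_evalSize`);
* **`booleanPart_VP_NC_two_of_finite_holds`**: for a p-computable family `f` over a finite field
  and `a ∈ k`, `{x | f_{|x|}(x) = a} ∈ NC 2` (the tree's non-uniform `NC²`, `ConstantDepth.lean`).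
  The hypothesis of (B3) that the values of `f` on Boolean points lie in the prime field is not
  needed for this conclusion (it only matters for reading the value as an element of `𝔽_p`).

## References

* P. Bürgisser, *Cook's versus Valiant's hypothesis*, Theoret. Comput. Sci. 235 (2000) 71–88:
  Thm. 1.1(2) (p. 73), Thm. 2.5 (p. 77), §5 (B) (p. 87).
* L. G. Valiant, S. Skyum, S. Berkowitz, C. Rackoff, *Fast parallel computation of polynomials
  using few processors*, SIAM J. Comput. 12 (1983) 641–644.
* P. Bürgisser, *Completeness and Reduction in Algebraic Complexity Theory*, Springer 2000,
  Thm. 4.5 (book version).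
-/

noncomputable section

open scoped Classical
open MvPolynomial Finset Literature.Computability.Complexity Literature.Computability.Complexity.FinEnc

namespace Literature.Computability.AlgebraicComplexity.DepthReduction

universe u v w

/-! ### Logarithms of p-bounded quantities -/

/-- `⌈log₂ m⌉ ≤ ⌊log₂ m⌋ + 1`. [folklore] -/
theorem clog_two_le_log_two_add_one (m : ℕ) : Nat.clog 2 m ≤ Nat.log 2 m + 1 := by
  rw [Nat.clog_le_iff_le_pow one_lt_two]
  exact (Nat.lt_pow_succ_log_self one_lt_two m).le

/-- `⌈log₂ m⌉ ≤ m + 1`. [folklore] -/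
theorem clog_two_le_succ (m : ℕ) : Nat.clog 2 m ≤ m + 1 :=
  (clog_two_le_log_two_add_one m).trans (Nat.add_le_add_right (Nat.log_le_self 2 m) 1)

/-- If `m ≤ n ^ e + e` then `⌊log₂ m⌋ ≤ e ⌊log₂ n⌋ + 2 e`. [folklore] -/
theorem log_two_le_of_le_pow_add {m n e : ℕ} (h : m ≤ n ^ e + e) :
    Nat.log 2 m ≤ e * Nat.log 2 n + 2 * e := by
  rcases Nat.eq_zero_or_pos e with rfl | he
  · simp only [pow_zero, add_zero] at h
    simp only [zero_mul, mul_zero, add_zero, nonpos_iff_eq_zero]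
    interval_cases m <;> simp
  set L := Nat.log 2 n with hL
  have hn : n < 2 ^ (L + 1) := Nat.lt_pow_succ_log_self one_lt_two n
  have h1 : n ^ e ≤ 2 ^ (e * (L + 1)) := by
    rw [pow_mul']
    exact Nat.pow_le_pow_left hn.le e
  have h2 : e ≤ 2 ^ e := Nat.lt_two_pow_self.le
  have h3 : m ≤ 2 ^ (e * L + 2 * e) := by
    have hA : 2 ≤ 2 ^ (e * (L + 1)) := by
      calc (2 : ℕ) = 2 ^ 1 := rfl
        _ ≤ 2 ^ (e * (L + 1)) := Nat.pow_le_pow_right two_pos (by nlinarith)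
    have hB : 2 ≤ 2 ^ e := by
      calc (2 : ℕ) = 2 ^ 1 := rfl
        _ ≤ 2 ^ e := Nat.pow_le_pow_right two_pos he
    calc m ≤ 2 ^ (e * (L + 1)) + 2 ^ e := h.trans (Nat.add_le_add h1 h2)
      _ ≤ 2 ^ (e * (L + 1)) * 2 ^ e := by nlinarith
      _ = 2 ^ (e * L + 2 * e) := by rw [← pow_add]; ring_nf
  calc Nat.log 2 m ≤ Nat.log 2 (2 ^ (e * L + 2 * e)) := Nat.log_mono_right h3
    _ = e * L + 2 * e := Nat.log_pow one_lt_two _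

/-- If `m ≤ n ^ e + e` then `⌈log₂ m⌉ ≤ e ⌊log₂ n⌋ + 2 e + 1`. [folklore] -/
theorem clog_two_le_of_le_pow_add {m n e : ℕ} (h : m ≤ n ^ e + e) :
    Nat.clog 2 m ≤ e * Nat.log 2 n + 2 * e + 1 :=
  (clog_two_le_log_two_add_one m).trans (Nat.add_le_add_right (log_two_le_of_le_pow_add h) 1)

/-- A quadratic in `T ≤ α L + β` is `≤ c L² + c` with `c = K₀ + K₁ (α + β) + 2 K₂ (α + β)²`
(the bookkeeping `O(log n) · O(log n) = O(log² n)`). [folklore] -/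
theorem quad_le_log_sq {K₀ K₁ K₂ α β L T : ℕ} (hT : T ≤ α * L + β) :
    K₀ + K₁ * T + K₂ * (T * T) ≤
      (K₀ + K₁ * (α + β) + 2 * K₂ * (α + β) ^ 2) * L ^ 2 +
        (K₀ + K₁ * (α + β) + 2 * K₂ * (α + β) ^ 2) := by
  have hT' : T ≤ (α + β) * (L + 1) := by nlinarith
  have hL1 : L + 1 ≤ L ^ 2 + 1 := by nlinarith
  have hL2 : (L + 1) * (L + 1) ≤ 2 * (L ^ 2 + 1) := by nlinarith
  have h1 : K₁ * T ≤ K₁ * (α + β) * (L ^ 2 + 1) := by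
    calc K₁ * T ≤ K₁ * ((α + β) * (L + 1)) := Nat.mul_le_mul_left _ hT'
      _ ≤ K₁ * ((α + β) * (L ^ 2 + 1)) := Nat.mul_le_mul_left _ (Nat.mul_le_mul_left _ hL1)
      _ = K₁ * (α + β) * (L ^ 2 + 1) := by ring
  have h2 : K₂ * (T * T) ≤ 2 * K₂ * (α + β) ^ 2 * (L ^ 2 + 1) := by
    calc K₂ * (T * T) ≤ K₂ * (((α + β) * (L + 1)) * ((α + β) * (L + 1))) :=
          Nat.mul_le_mul_left _ (Nat.mul_le_mul hT' hT')
      _ = K₂ * (α + β) ^ 2 * ((L + 1) * (L + 1)) := by ring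
      _ ≤ K₂ * (α + β) ^ 2 * (2 * (L ^ 2 + 1)) := Nat.mul_le_mul_left _ hL2
      _ = 2 * K₂ * (α + β) ^ 2 * (L ^ 2 + 1) := by ring
  nlinarith

namespace HomCircuit

/-! ### Monotonicity of the depth and size of the stages in the number of nodes -/

/-- `sumDepth` is monotone in the number of nodes. [folklore] -/
theorem sumDepth_mono {nι nι' : ℕ} (h : nι ≤ nι') (Q dT : ℕ) : sumDepth nι Q dT ≤ sumDepth nι' Q dT :=
  Nat.add_le_add_left (Nat.mul_le_mul_right _ (Nat.clog_mono_right 2 h)) _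

/-- `sumSize` is monotone in the number of nodes. [folklore] -/
theorem sumSize_mono {nι nι' : ℕ} (h : nι ≤ nι') (Q sT : ℕ) : sumSize nι Q sT ≤ sumSize nι' Q sT :=
  Nat.add_le_add (Nat.mul_le_mul_right _ h) (Nat.mul_le_mul_right _ (Nat.sub_le_sub_right h 1))

/-- `stageZeroDepth` is monotone in the number of nodes. [folklore] -/
theorem stageZeroDepth_mono {nι nι' : ℕ} (h : nι ≤ nι') (nσ Q : ℕ) :
    stageZeroDepth nι nσ Q ≤ stageZeroDepth nι' nσ Q :=
  Nat.add_le_add_left (sumDepth_mono h _ _) _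

/-- `stageZeroSize` is monotone in the number of nodes. [folklore] -/
theorem stageZeroSize_mono {nι nι' : ℕ} (h : nι ≤ nι') (nσ Q : ℕ) :
    stageZeroSize nι nσ Q ≤ stageZeroSize nι' nσ Q := by
  unfold stageZeroSize baseValSize baseQuotSize
  exact Nat.add_le_add (Nat.mul_le_mul_right _ h)
    (Nat.mul_le_mul (Nat.mul_le_mul h h) (Nat.add_le_add_right (sumSize_mono h _ _) _))

/-- `stageDepth` is monotone in the number of nodes. [folklore] -/
theorem stageDepth_mono {nι nι' : ℕ} (h : nι ≤ nι') (Q : ℕ) : stageDepth nι Q ≤ stageDepth nι' Q :=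
  Nat.add_le_add (sumDepth_mono h _ _) (sumDepth_mono h _ _)

/-- `stageSize` is monotone in the number of nodes. [folklore] -/
theorem stageSize_mono {nι nι' : ℕ} (h : nι ≤ nι') (Q : ℕ) : stageSize nι Q ≤ stageSize nι' Q := by
  unfold stageSize halfSize
  exact Nat.mul_le_mul_left _ (Nat.mul_le_mul (Nat.add_le_add h (Nat.mul_le_mul h h))
    (Nat.add_le_add_right (sumSize_mono h _ _) _))

/-! ### Deciding `Σⱼ [νⱼ](x) = a` for a homogeneous circuit over a finite semiring -/

section Decide

variable {k : Type u} {σ : Type v} {ι : Type w} [CommSemiring k] [Fintype k]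
variable {H : HomCircuit k σ ι} [DecidableEq ι] [Fintype ι] [Fintype σ] [DecidableEq σ]

/-- **Deciding `Σⱼ [νⱼ](x) = a`** for a homogeneous circuit certificate `H` over a finite
commutative semiring with all formal degrees `≤ D`: after the `⌈log₂ D⌉` VSBR stages
(`stageReal`, `entry_inl_eq`) the code words of the `M ≥ 1` node values `[νⱼ](x)` are summed by a
balanced tree of addition gadgets (`ncVec_sumEnc`) and compared with the code word of `a`
(`ncVec_eqEnc`) (Bürgisser 2000 TCS, §5 (B), p. 87). [cite: Burgisser2000TCS, §5 (B) p. 87] [cite: ValiantSkyumBerkowitzRackoff1983] -/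
theorem ncVec_decide_sum_val_eq {D M : ℕ} (hD : ∀ ν, H.deg ν ≤ D) (hM : 1 ≤ M) (ν : Fin M → ι)
    (a : k) :
    NCVec (fun (x : σ → Bool) (_ : Unit) => decide (∑ j, eval (bpt x) (H.val (ν j)) = a))
      (stageZeroDepth (Fintype.card ι) (Fintype.card σ) (Fintype.card k) +
        Nat.clog 2 D * stageDepth (Fintype.card ι) (Fintype.card k) +
        Nat.clog 2 M * (4 * Fintype.card k + 1) + (2 * Fintype.card k + 1))
      (stageZeroSize (Fintype.card ι) (Fintype.card σ) (Fintype.card k) +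
        Nat.clog 2 D * stageSize (Fintype.card ι) (Fintype.card k) +
        (M - 1) * (Fintype.card k * univBound (2 * Fintype.card k)) + univBound (Fintype.card k)) := by
  have hst := (H.stageReal (Nat.clog 2 D)).outMap
    fun p : Fin M × Fin (Fintype.card k) => ((Sum.inl (ν p.1) : ι ⊕ (ι × ι)), p.2)
  have hst' : NCVec (fun (x : σ → Bool) (p : Fin M × Fin (Fintype.card k)) =>
      enc (eval (bpt x) (H.val (ν p.1))) p.2) _ _ :=
    hst.congr fun x p => by
      simp only
      rw [H.entry_inl_eq hD x (ν p.1)]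
  have hsum := ncVec_sumEnc (A := k) (a := fun x j => eval (bpt x) (H.val (ν j))) hM hst'
  have h := hsum.comp (ncVec_eqEnc (A := k) a)
  refine h.congr fun x _ => ?_
  change decide ((fun i => enc (∑ j, eval (bpt x) (H.val (ν j))) i) = enc a) = _
  by_cases he : ∑ j, eval (bpt x) (H.val (ν j)) = a
  · rw [he]; simp
  · have hne : (fun i => enc (∑ j, eval (bpt x) (H.val (ν j))) i) ≠ enc a := fun h' =>
      he (enc_injective (funext fun i => congrFun h' i))
    simp [he, hne]

end Decide

end HomCircuit

/-! ### Deciding `f(x) = a` for a value of a straight-line program, and for any polynomial -/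

section Eval

open HomCircuit

variable {k : Type u} {σ : Type v} [CommSemiring k] [Fintype k] [Fintype σ] [DecidableEq σ]

/-- **Deciding `f(x) = a` for a value of a straight-line program** of length `L` and total degree
`≤ d` over a finite commutative semiring: homogenise in degree `≤ d` (`SLP.homogenize`, at most
`4 L (d + 1)²` nodes of formal degree `≤ d`, `SLP.card_node_le`), run the `⌈log₂ d⌉` VSBR stages
and sum the `d + 1` homogeneous components of the output line (Bürgisser 2000 TCS, Thm. 2.5 and
§5 (B)). [cite: Burgisser2000TCS, Thm. 2.5 p. 77 and §5 (B) p. 87] [cite: ValiantSkyumBerkowitzRackoff1983] -/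
theorem ncVec_decide_eval_slp_eq (S : SLP k σ) {i : ℕ} (hi : i < S.len) {d : ℕ}
    (hd : (S.val i).totalDegree ≤ d) (a : k) :
    NCVec (fun (x : σ → Bool) (_ : Unit) => decide (eval (bpt x) (S.val i) = a))
      (stageZeroDepth (4 * S.len * (d + 1) ^ 2) (Fintype.card σ) (Fintype.card k) +
        Nat.clog 2 d * stageDepth (4 * S.len * (d + 1) ^ 2) (Fintype.card k) +
        Nat.clog 2 (d + 1) * (4 * Fintype.card k + 1) + (2 * Fintype.card k + 1))
      (stageZeroSize (4 * S.len * (d + 1) ^ 2) (Fintype.card σ) (Fintype.card k) +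
        Nat.clog 2 d * stageSize (4 * S.len * (d + 1) ^ 2) (Fintype.card k) +
        d * (Fintype.card k * univBound (2 * Fintype.card k)) + univBound (Fintype.card k)) := by
  have hdeg : ∀ ν, (S.homogenize d).deg ν ≤ d := by
    rintro ⟨j, tg⟩
    change S.hdeg d (j, tg) ≤ d
    cases tg <;> simp only [SLP.hdeg] <;> omega
  have h := ncVec_decide_sum_val_eq (H := S.homogenize d) hdeg (Nat.succ_le_succ (Nat.zero_le d))
    (fun e : Fin (d + 1) => ((⟨i, hi⟩ : Fin S.len), SLP.Tag.Q e)) a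
  have hsum : ∀ x : σ → Bool,
      ∑ e : Fin (d + 1), eval (bpt x) ((S.homogenize d).val (⟨i, hi⟩, SLP.Tag.Q e)) =
        eval (bpt x) (S.val i) := by
    intro x
    rw [← map_sum]
    congr 1
    change ∑ e : Fin (d + 1), S.hval d (⟨i, hi⟩, SLP.Tag.Q e) = S.val i
    simp only [SLP.hval_Q]
    rw [Fin.sum_univ_eq_sum_range (fun e => homogeneousComponent e (S.val i)) (d + 1)]
    exact sum_homogeneousComponent_of_le hd
  have hN := S.card_node_le d
  refine (h.congr fun x _ => by rw [hsum x]).mono ?_ ?_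
  · exact Nat.add_le_add_right (Nat.add_le_add_right (Nat.add_le_add (stageZeroDepth_mono hN _ _)
      (Nat.mul_le_mul_left _ (stageDepth_mono hN _))) _) _
  · exact Nat.add_le_add_right (Nat.add_le_add (Nat.add_le_add (stageZeroSize_mono hN _ _)
      (Nat.mul_le_mul_left _ (stageSize_mono hN _))) (Nat.mul_le_mul_right _ (by simp))) _

omit [CommSemiring k] in
/-- The code words of `u` and `a` agree iff `u = a`, as a `decide`d bit. [folklore] -/
theorem decide_enc_eq_enc (u a : k) : decide (enc u = enc a) = decide (u = a) := by
  by_cases h : u = a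
  · subst h; simp
  · simp [h, enc_injective.eq_iff]

/-- **Deciding `f(x) = a` for an arbitrary polynomial** over a finite commutative semiring, on
Boolean inputs, by `B₂`-circuits whose depth and size are those of the program case for
`L = complexity f`, `d = deg f` plus the cost of one literal/constant and one comparison: an optimal
fan-in-two circuit for `f` is a straight-line program (`exists_slp`) to which the previous
construction applies; the degenerate outputs (a variable, a constant) are an input literal or a
constant code word compared with `a` (Bürgisser 2000 TCS, §5 (B), p. 87). [cite: Burgisser2000TCS, §5 (B) p. 87] -/
theorem ncVec_decide_eval_eq (g : MvPolynomial σ k) (a : k) :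
    NCVec (fun (x : σ → Bool) (_ : Unit) => decide (eval (bpt x) g = a))
      (stageZeroDepth (4 * complexity g * (g.totalDegree + 1) ^ 2) (Fintype.card σ) (Fintype.card k) +
        Nat.clog 2 g.totalDegree *
          stageDepth (4 * complexity g * (g.totalDegree + 1) ^ 2) (Fintype.card k) +
        Nat.clog 2 (g.totalDegree + 1) * (4 * Fintype.card k + 1) + (2 * Fintype.card k + 1) +
        (2 * Fintype.card k + 4))
      (stageZeroSize (4 * complexity g * (g.totalDegree + 1) ^ 2) (Fintype.card σ) (Fintype.card k) +
        Nat.clog 2 g.totalDegree *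
          stageSize (4 * complexity g * (g.totalDegree + 1) ^ 2) (Fintype.card k) +
        g.totalDegree * (Fintype.card k * univBound (2 * Fintype.card k)) +
        univBound (Fintype.card k) +
        (Fintype.card k * univBound 1 + univBound (Fintype.card k))) := by
  obtain ⟨P, hfan, hcomp, hsize⟩ := ArithCircuit.exists_computes_size_eq_complexity g
  obtain ⟨S, hlen, hcases⟩ := exists_slp P hfan
  rw [show P.eval = g from hcomp] at hcases
  rcases hcases with ⟨i, hi, hgi⟩ | ⟨j, hgj⟩ | ⟨c, hgc⟩
  · have h := ncVec_decide_eval_slp_eq S hi (d := g.totalDegree) (by rw [← hgi]) a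
    rw [hlen, hsize] at h
    exact (h.congr fun x _ => by rw [← hgi]).mono (Nat.le_add_right _ _) (Nat.le_add_right _ _)
  · have h := (ncVec_bitEnc (A := k) j (0 : k) 1).comp (ncVec_eqEnc (A := k) a)
    refine (h.congr fun x _ => ?_).mono (by omega) (Nat.le_add_left _ _)
    rw [decide_enc_eq_enc, hgj, eval_X]
    rfl
  · have h := (ncVec_constEnc (ι := σ) (A := k) c).comp (ncVec_eqEnc (A := k) a)
    refine (h.congr fun x _ => ?_).mono (by omega) ?_
    · rw [decide_enc_eq_enc, hgc, eval_C]
    · have h1 : Fintype.card k ≤ Fintype.card k * univBound 1 :=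
        Nat.le_mul_of_pos_right _ (univBound_pos 1)
      omega

end Eval

/-! ### Bookkeeping: depth `O(log² n)` and polynomial size along a `VP` family -/

section Bookkeeping

open HomCircuit

/-- **The depth is quadratic in the logarithms**: if `T` bounds `⌈log₂ (nσ + 1)⌉`,
`⌈log₂ (4 L (d+1)²)⌉`, `⌈log₂ d⌉` and `⌈log₂ (d + 1)⌉`, then the depth of `ncVec_decide_eval_eq`
is `≤ (6Q + 9) + (24Q + 5) T + (8Q + 2) T²` (stage `0`: `O(log nσ + log N)`; each of the
`⌈log₂ d⌉` stages: `O(log N)`; Bürgisser 2000 TCS, Thm. 2.5: depth `O(log(d L) log d + log n)`).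
[cite: Burgisser2000TCS, Thm. 2.5 p. 77] -/
theorem evalDepth_le_quad {L nσ Q d T : ℕ} (h1 : Nat.clog 2 (nσ + 1) ≤ T)
    (h2 : Nat.clog 2 (4 * L * (d + 1) ^ 2) ≤ T) (h3 : Nat.clog 2 d ≤ T) (h4 : Nat.clog 2 (d + 1) ≤ T) :
    stageZeroDepth (4 * L * (d + 1) ^ 2) nσ Q + Nat.clog 2 d * stageDepth (4 * L * (d + 1) ^ 2) Q +
        Nat.clog 2 (d + 1) * (4 * Q + 1) + (2 * Q + 1) + (2 * Q + 4) ≤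
      (6 * Q + 9) + (24 * Q + 5) * T + (8 * Q + 2) * (T * T) := by
  unfold stageZeroDepth baseValDepth baseQuotDepth stageDepth halfDepth sumDepth
  set A := Nat.clog 2 (nσ + 1)
  set B := Nat.clog 2 (4 * L * (d + 1) ^ 2)
  set C := Nat.clog 2 d
  set E := Nat.clog 2 (d + 1)
  have hAQ : A * Q ≤ T * Q := Nat.mul_le_mul_right _ h1
  have hBQ : B * Q ≤ T * Q := Nat.mul_le_mul_right _ h2
  have hCQ : C * Q ≤ T * Q := Nat.mul_le_mul_right _ h3
  have hEQ : E * Q ≤ T * Q := Nat.mul_le_mul_right _ h4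
  have hCB : C * B ≤ T * T := Nat.mul_le_mul h3 h2
  have hCBQ : C * B * Q ≤ T * T * Q := Nat.mul_le_mul_right _ hCB
  nlinarith [hAQ, hBQ, hCQ, hEQ, hCB, hCBQ, h1, h2, h3, h4]

variable {L d : ℕ → ℕ}

/-- The node bound `4 L (d + 1)²` is p-bounded along p-bounded `L`, `d`. [folklore] -/
theorem isPBounded_nodeBound (hL : IsPBounded L) (hd : IsPBounded d) :
    IsPBounded fun n => 4 * L n * (d n + 1) ^ 2 :=
  IsPBounded.mul_holds (IsPBounded.mul_holds (IsPBounded.const 4) hL)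
    (IsPBounded.pow_holds (IsPBounded.add_holds hd (IsPBounded.const 1)) 2)

/-- `sumSize` is p-bounded along a p-bounded number of nodes. [folklore] -/
theorem isPBounded_sumSize {N : ℕ → ℕ} (hN : IsPBounded N) (Q sT : ℕ) :
    IsPBounded fun n => sumSize (N n) Q sT :=
  (IsPBounded.add_holds (IsPBounded.mul_holds hN (IsPBounded.const sT))
    (IsPBounded.mul_holds hN (IsPBounded.const (Q * univBound (2 * Q))))).mono fun _ =>
    Nat.add_le_add_left (Nat.mul_le_mul_right _ (Nat.sub_le _ _)) _

/-- `stageZeroSize` is p-bounded along a p-bounded number of nodes. [folklore] -/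
theorem isPBounded_stageZeroSize {N : ℕ → ℕ} (hN : IsPBounded N) (Q : ℕ) :
    IsPBounded fun n => stageZeroSize (N n) n Q := by
  unfold stageZeroSize baseValSize baseQuotSize
  refine IsPBounded.add_holds (IsPBounded.mul_holds hN (IsPBounded.add_holds
    (IsPBounded.mul_holds (IsPBounded.add_holds IsPBounded.id (IsPBounded.const 1))
      (IsPBounded.const _)) (IsPBounded.mul_holds IsPBounded.id (IsPBounded.const _)))) ?_
  exact IsPBounded.mul_holds (IsPBounded.mul_holds hN hN)
    (IsPBounded.add_holds (isPBounded_sumSize hN Q _) (IsPBounded.const Q))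

/-- `stageSize` is p-bounded along a p-bounded number of nodes. [folklore] -/
theorem isPBounded_stageSize {N : ℕ → ℕ} (hN : IsPBounded N) (Q : ℕ) :
    IsPBounded fun n => stageSize (N n) Q := by
  unfold stageSize halfSize
  exact IsPBounded.mul_holds (IsPBounded.const 2) (IsPBounded.mul_holds
    (IsPBounded.add_holds hN (IsPBounded.mul_holds hN hN))
    (IsPBounded.add_holds (isPBounded_sumSize hN Q _) (IsPBounded.const Q)))

/-- **The size is polynomial**: the size of `ncVec_decide_eval_eq` is p-bounded along p-bounded
`L`, `d` (Bürgisser 2000 TCS, §5 (B): "Boolean circuits of size `n^{O(1)}`"). [cite: Burgisser2000TCS, §5 (B) p. 87] -/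
theorem isPBounded_evalSize (hL : IsPBounded L) (hd : IsPBounded d) (Q : ℕ) :
    IsPBounded fun n =>
      stageZeroSize (4 * L n * (d n + 1) ^ 2) n Q + Nat.clog 2 (d n) * stageSize (4 * L n * (d n + 1) ^ 2) Q +
        d n * (Q * univBound (2 * Q)) + univBound Q + (Q * univBound 1 + univBound Q) := by
  have hN := isPBounded_nodeBound hL hd
  have hclog : IsPBounded fun n => Nat.clog 2 (d n) :=
    (IsPBounded.add_holds hd (IsPBounded.const 1)).mono fun n => clog_two_le_succ (d n)
  exact IsPBounded.add_holds (IsPBounded.add_holds (IsPBounded.add_holds (IsPBounded.add_holds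
    (isPBounded_stageZeroSize hN Q) (IsPBounded.mul_holds hclog (isPBounded_stageSize hN Q)))
    (IsPBounded.mul_holds hd (IsPBounded.const _))) (IsPBounded.const _)) (IsPBounded.const _)

/-- **The depth is `O(log² n)`**: along p-bounded `L`, `d` there is `c` such that the depth of
`ncVec_decide_eval_eq` is `≤ c log₂² n + c` for all `n` (Bürgisser 2000 TCS, §5 (B): "depth
`O(log² n)`"). [cite: Burgisser2000TCS, §5 (B) p. 87] -/
theorem evalDepth_le_log_sq (hL : IsPBounded L) (hd : IsPBounded d) (Q : ℕ) :
    ∃ c : ℕ, ∀ n,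
      stageZeroDepth (4 * L n * (d n + 1) ^ 2) n Q + Nat.clog 2 (d n) * stageDepth (4 * L n * (d n + 1) ^ 2) Q +
          Nat.clog 2 (d n + 1) * (4 * Q + 1) + (2 * Q + 1) + (2 * Q + 4) ≤
        c * Nat.log 2 n ^ 2 + c := by
  -- one exponent bounding all the logarithm arguments
  obtain ⟨e, he⟩ : IsPBounded fun n => (n + 1) + 4 * L n * (d n + 1) ^ 2 + (d n + 1) :=
    IsPBounded.add_holds (IsPBounded.add_holds (IsPBounded.add_holds IsPBounded.id
      (IsPBounded.const 1)) (isPBounded_nodeBound hL hd)) (IsPBounded.add_holds hd (IsPBounded.const 1))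
  refine ⟨(6 * Q + 9) + (24 * Q + 5) * (e + (2 * e + 1)) + 2 * (8 * Q + 2) * (e + (2 * e + 1)) ^ 2,
    fun n => ?_⟩
  set T := e * Nat.log 2 n + 2 * e + 1 with hT
  have hb : ∀ m, m ≤ (n + 1) + 4 * L n * (d n + 1) ^ 2 + (d n + 1) → Nat.clog 2 m ≤ T :=
    fun m hm => clog_two_le_of_le_pow_add (hm.trans (he n))
  have h := evalDepth_le_quad (L := L n) (nσ := n) (Q := Q) (d := d n) (T := T)
    (hb _ (by omega)) (hb _ (by omega)) (hb _ (by omega)) (hb _ (by omega))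
  exact h.trans (quad_le_log_sq (α := e) (β := 2 * e + 1) (L := Nat.log 2 n) (by rw [hT]; omega))

end Bookkeeping

end Literature.Computability.AlgebraicComplexity.DepthReduction

/-! ### The discharge of (B3) -/

namespace Literature.Computability.AlgebraicComplexity

open DepthReduction DepthReduction.HomCircuit

universe u

/-- **Discharge of (B3)** `booleanPart_VP_NC_two_of_finite k` (Bürgisser 2000 TCS, Thm. 1.1(2),
p. 73, `BP(VP_k) ⊆ FNC²/poly` for a finite field `k`; proof §5 (B), p. 87, by Thm. 2.5 =
Valiant–Skyum–Berkowitz–Rackoff and direct Boolean simulation of `k`-arithmetic): for a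
p-computable family `f`, `fₙ ∈ k[X₁, …, Xₙ]`, and `a ∈ k`, the language `{x | f_{|x|}(x) = a}` is
decided by the `B₂`-circuits `ncVec_decide_eval_eq (f n) a` of depth `≤ c log₂² n + c`
(`evalDepth_le_log_sq`) and polynomial size (`isPBounded_evalSize`), i.e. lies in the tree's
non-uniform `NC 2`. The hypothesis that the Boolean values of `f` lie in the prime field is not
used. Users are fed `booleanPart_VP_NC_two_of_finite_holds k`. [cite: Burgisser2000TCS, Thm. 1.1(2) p. 73 and §5 (B) p. 87, with Thm. 2.5 p. 77] [cite: ValiantSkyumBerkowitzRackoff1983] [cite: Burgisser2000, Thm. 4.5] -/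
theorem booleanPart_VP_NC_two_of_finite_holds (k : Type u) [Field k] :
    booleanPart_VP_NC_two_of_finite k := by
  intro _ f hf _ a
  letI : Fintype k := Fintype.ofFinite k
  obtain ⟨⟨-, hdeg⟩, hL⟩ := hf
  set Q := Fintype.card k with hQ
  -- the circuits
  have hC : ∀ n, ∃ C : Circuit (Fin n), C.IsOver B2 ∧
      C.acDepth ≤ stageZeroDepth (4 * complexity (f n) * ((f n).totalDegree + 1) ^ 2) n Q +
        Nat.clog 2 (f n).totalDegree * stageDepth (4 * complexity (f n) * ((f n).totalDegree + 1) ^ 2) Q +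
        Nat.clog 2 ((f n).totalDegree + 1) * (4 * Q + 1) + (2 * Q + 1) + (2 * Q + 4) ∧
      C.size ≤ stageZeroSize (4 * complexity (f n) * ((f n).totalDegree + 1) ^ 2) n Q +
        Nat.clog 2 (f n).totalDegree * stageSize (4 * complexity (f n) * ((f n).totalDegree + 1) ^ 2) Q +
        (f n).totalDegree * (Q * univBound (2 * Q)) + univBound Q + (Q * univBound 1 + univBound Q) ∧
      ∀ x, C.eval x = decide (eval (bpt x) (f n) = a) := by
    intro n
    have h := (ncVec_decide_eval_eq (f n) a).toCircuit
    simpa only [Fintype.card_fin] using h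
  choose C hC using hC
  obtain ⟨c, hc⟩ := evalDepth_le_log_sq (L := fun n => complexity (f n))
    (d := fun n => (f n).totalDegree) hL hdeg Q
  obtain ⟨p, hp⟩ := (isPBounded_iff_exists_polynomial_holds _).1
    (isPBounded_evalSize (L := fun n => complexity (f n)) (d := fun n => (f n).totalDegree) hL hdeg Q)
  refine ⟨c, p, C, fun n => ⟨(hC n).1, (hC n).2.1.trans (hc n), (hC n).2.2.1.trans (hp n)⟩, ?_⟩
  intro x
  rw [(hC x.length).2.2.2 x.get, show (bpt x.get : Fin x.length → k) = boolPoint k x.get from rfl]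
  unfold Set.boolIndicator
  by_cases hx : eval (boolPoint k x.get) (f x.length) = a
  · have hx' : x ∈ {w : List Bool | eval (boolPoint k w.get) (f w.length) = a} := hx
    rw [if_pos hx']
    simpa using hx
  · have hx' : x ∉ {w : List Bool | eval (boolPoint k w.get) (f w.length) = a} := hx
    rw [if_neg hx']
    simpa using hx

end Literature.Computability.AlgebraicComplexity
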